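import Mathlib.Analysis.SpecialFunctions.Pow.Real
import Mathlib.Topology.MetricSpace.Basic

/-!
# `Balaban1983to89.B9Eq387IMSMassWindow` — T. Bałaban, *Propagators for lattice gauge theories in a background field*, Commun. Math. Phys. **99**
# (1985) 389–434 [Balaban1985BackgroundPropagators] p. 414 l.1–3 («They are of the order O(M⁻¹), or O(M⁻²), if considered on a proper scale»),
# (3.87)–(3.89) p. 409, Thm 3.11 p. 416: **THE MASS CONSTANT OF KERNEL 7 SURVIVES — `∃ ε₀ > 0, ∃ M₁`, such that for every bond window `ε_U ≤ ε₀` and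
# every partition scale `M₀ ≥ M₁` the correction rows of the row-L11 junction eat at most half of the local constant:
# `γ₀∕2 ≤ γ₀ − b_W(M₀) − (1 − γ₁)(b₁(M₀) + b₂(M₀) + a·b₃(M₀, ε_U))`** — the real-analysis half of «Tier P at the lattice, `∃`-first, modulo (loc)»:
# the rows of `B9Eq387IMSAssemblySmallField.ims_assembly_strong_small_background` (gen 86) are polynomials in `1∕M₀` and `ε_U` without constant
# term, so they vanish at `(1∕M₀, ε_U) = (0, 0)` and stay `≤ γ₀∕2` nearby; Mathlib-only; route R2′ STEP B8′ of the pub-balaban NE9 chain,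
# instance-ledger row L11's «`M₀` NEEDS-CONSTANT» (`t4/ROUTES-NE9.md` v13.30–v13.44)

statement-level skeleton of published theorems with citation tags; proofs where landed; nothing here is a claim about the Yang–Mills mass gap

CITATION HEADER (lean-in-tree rule).  Audit cell `pub-balaban`, sub-cell `t4`, BINDER row NE9; filed by NE9 formalisation-swarm LEAF PROVER 01
(`b2b-balaban-t4-ne9-formalise-leaf-01`, gen 86).  Companion of this lineage's `B9Eq387IMSAssemblySmallField` (the junction whose rows it bounds; the
letters `C_W, C₇, k, Λ, s_C, θ₁, r` below abstract that file's `2(C_Ψ⁰(δ) + 2√a′)`, `2·7^{d+1}`, `k`, `(16∕κ² + 2)K_{d+1}(κ∕2)`, `√(c₁∕(c₀L^{d+1}))`,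
`M_φ′M_φ√(2(d+1)c₁∕c₀)`, `c₁∕(c₀L^{d+1})`) and of `B9Eq349DPWindowsRadius` (same continuity-at-`0` device).  Source READ in the held text
[Balaban1985BackgroundPropagators] (journal page = PDF page + 388): p. 414 l.1–3 *«They are of the order O(M⁻¹), or O(M⁻²), if considered on a proper
scale»*, p. 409 (3.87)–(3.89), p. 416 Thm 3.11.  Print's `M` is chosen «sufficiently large» on p. 414; the threshold below is the ROUTE's bookkeeping
(existence by continuity, NO closed form), nothing of [B9] is asserted.

WHAT IS PROVED (sorry-free; proof lane — no `def`; [folklore] elementary real analysis).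
* **`exists_mass_window`** — for ANY reals `η, M_T, a, C_W, C₇, k, Λ, s_C, θ₁, r, γ₁` and `γ₀ > 0`: `∃ ε₀ > 0, ∃ M₁ ≥ 1, ∀ ε_U ∈ [0, ε₀], ∀ M₀ ≥ M₁`,
  `γ₀∕2 ≤ γ₀ − C_W·(4C₇·((4(d+1)L∕M₀)²·k·Λ)) − (1 − γ₁)·(b₁ + b₂ + a·b₃)` with `b₁, b₂, b₃` in the EXACT text of the junction's conclusion at dimension `d + 1`
  (letters substituted as in the CITATION HEADER).
HONEST SCOPE.  Thresholds by continuity of an explicit polynomial in `(1∕M₀, ε_U)` at the origin — existence only, NO closed-form `M₁(γ₀, …)`, NO number;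
the local constant `γ₀` (row L10, (loc)) is an INPUT fixed first; nothing about operators.  NOT NE9 (cell pub-balaban: NE9 NOT PRINTED ∕ NOT PROVED; «NE9 ⇐ the
named binders»; row WALLED ON A MODEL (O-NE9-1; #5 UNRULED); spine PROVED 0∕9; rung (B)+1 on a finite T⁴ — NOT infinite volume, NOT mass gap, NOT BetaPertH, NOT
Clay; HONEST DEPENDENCY: continuum YM on T⁴ ⇐ BetaPertH ∧ nine spine estimates (0/9 proved); BetaPertH ⇐ (D1) ∧ (D4) ∧ CAP+tail; G-an2-4 gates asym, D1 and
NE2/3/4).  NEW file, Mathlib-only imports; nothing modified.  Net new unproved facts: 0.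
-/

noncomputable section

set_option autoImplicit false

open Filter Topology

namespace Literature.MathematicalPhysics.QuantumFieldTheory.Balaban1983to89.B9Eq387IMSMassWindow

/-- **THE MASS CONSTANT SURVIVES (`∃ ε₀ M₁` first).**  For every `γ₀ > 0` and all real letters, there are `ε₀ > 0` and `M₁ ≥ 1` such that for
`0 ≤ ε_U ≤ ε₀` and `M₀ ≥ M₁` the junction's bracket is `≥ γ₀∕2`.  PROOF: the subtracted rows, read as a function `S(w, ε)` of `w = 1∕M₀` and `ε = ε_U`,
form a polynomial (continuous, `fun_prop`) with `S(0, 0) = 0 < γ₀∕2`; a ball of radius `δ` around the origin in `ℝ × ℝ` keeps `S < γ₀∕2`; take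
`ε₀ := δ∕2`, `M₁ := ⌈2∕δ⌉₊ + 1`, and identify `S(1∕M₀, ε_U)` with the bracket by `ring`. [folklore]
[cite: Balaban1985BackgroundPropagators, p.414 «O(M⁻¹), or O(M⁻²) … on a proper scale», (3.87)–(3.89) p.409, Thm 3.11 p.416] -/
theorem exists_mass_window (d L : ℕ) (η MT a CW C7 k Λ sC θ₁ rr γ₁ : ℝ) {γ₀ : ℝ} (hγ₀ : 0 < γ₀) :
    ∃ ε₀ : ℝ, 0 < ε₀ ∧ ∃ M₁ : ℕ, 1 ≤ M₁ ∧ ∀ εU : ℝ, 0 ≤ εU → εU ≤ ε₀ → ∀ M₀ : ℕ, M₁ ≤ M₀ →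
      γ₀ / 2 ≤ γ₀ - CW * (4 * C7 * ((4 * ((d + 1 : ℕ) : ℝ) * L / M₀) ^ 2 * k * Λ)) -
        (1 - γ₁) *
          ((16 * ((d + 1 : ℕ) : ℝ) * ((1 + MT) * MT * (64 * ((M₀ : ℝ) * η)⁻¹ ^ 2)) +
                8 * ((d + 1 : ℕ) : ℝ) * MT ^ 2 * (64 * ((M₀ : ℝ) * η)⁻¹ ^ 2)) +
            (2 * ((d + 1 : ℕ) : ℝ) * ((1 + MT) * MT * (64 * ((M₀ : ℝ) * η)⁻¹ ^ 2)) +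
                ((d + 1 : ℕ) : ℝ) * MT ^ 2 * (64 * ((M₀ : ℝ) * η)⁻¹ ^ 2)) +
            a * ((sC + θ₁ * (102 * (((d + 1 : ℕ) : ℝ) + 1) ^ 2 * L * εU)) *
                (256 * ((d + 1 : ℕ) : ℝ) * ((L : ℝ) - 1) ^ 2 / (M₀ : ℝ) ^ 2 * sC + 4 * (θ₁ * (102 * (((d + 1 : ℕ) : ℝ) + 1) ^ 2 * L * εU))) +
              (2 * (256 * ((d + 1 : ℕ) : ℝ) * ((L : ℝ) - 1) ^ 2 / (M₀ : ℝ) ^ 2 * rr) +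
                8 * (θ₁ * (102 * (((d + 1 : ℕ) : ℝ) + 1) ^ 2 * L * εU)) ^ 2))) := by
  -- the polynomial model `S(w, ε)`, `w = 1∕M₀`
  obtain ⟨dR, hdR⟩ : ∃ dR : ℝ, dR = ((d + 1 : ℕ) : ℝ) := ⟨_, rfl⟩
  obtain ⟨S, hS⟩ : ∃ S : ℝ × ℝ → ℝ, S = fun p =>
      CW * (4 * C7 * ((4 * dR * L * p.1) ^ 2 * k * Λ)) +
        (1 - γ₁) *
          ((16 * dR * ((1 + MT) * MT * (64 * (p.1 * η⁻¹) ^ 2)) + 8 * dR * MT ^ 2 * (64 * (p.1 * η⁻¹) ^ 2)) +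
            (2 * dR * ((1 + MT) * MT * (64 * (p.1 * η⁻¹) ^ 2)) + dR * MT ^ 2 * (64 * (p.1 * η⁻¹) ^ 2)) +
            a * ((sC + θ₁ * (102 * (dR + 1) ^ 2 * L * p.2)) *
                (256 * dR * ((L : ℝ) - 1) ^ 2 * p.1 ^ 2 * sC + 4 * (θ₁ * (102 * (dR + 1) ^ 2 * L * p.2))) +
              (2 * (256 * dR * ((L : ℝ) - 1) ^ 2 * p.1 ^ 2 * rr) + 8 * (θ₁ * (102 * (dR + 1) ^ 2 * L * p.2)) ^ 2))) := ⟨_, rfl⟩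
  have hSc : Continuous S := by rw [hS]; fun_prop
  have hS0 : S (0, 0) = 0 := by rw [hS]; simp
  have hS0' : S (0, 0) < γ₀ / 2 := by rw [hS0]; positivity
  have hev : ∀ᶠ p in 𝓝 ((0 : ℝ), (0 : ℝ)), S p < γ₀ / 2 := (hSc.tendsto _).eventually (eventually_lt_nhds hS0')
  obtain ⟨δ, hδ, hball⟩ := Metric.eventually_nhds_iff.mp hev
  refine ⟨δ / 2, half_pos hδ, ⌈2 / δ⌉₊ + 1, by omega, fun εU hε0 hε M₀ hM => ?_⟩
  -- `w = 1∕M₀ < δ` and `ε_U < δ`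
  have hM1 : (⌈2 / δ⌉₊ : ℝ) + 1 ≤ (M₀ : ℝ) := by exact_mod_cast hM
  have hM2 : 2 / δ < (M₀ : ℝ) := by linarith [Nat.le_ceil (2 / δ)]
  have hMpos : (0 : ℝ) < (M₀ : ℝ) := lt_trans (by positivity) hM2
  have hw : (M₀ : ℝ)⁻¹ < δ := by
    rw [inv_lt_comm₀ hMpos hδ]
    have : δ⁻¹ = 1 / δ := (one_div δ).symm
    rw [this]
    linarith [show 1 / δ ≤ 2 / δ from by gcongr; norm_num]
  have hwε : dist ((M₀ : ℝ)⁻¹, εU) ((0 : ℝ), (0 : ℝ)) < δ := by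
    rw [Prod.dist_eq, Real.dist_eq, Real.dist_eq, sub_zero, sub_zero, abs_of_nonneg (inv_nonneg.mpr hMpos.le), abs_of_nonneg hε0]
    exact max_lt hw (by linarith)
  have hlt : S ((M₀ : ℝ)⁻¹, εU) < γ₀ / 2 := hball hwε
  -- the model agrees with the bracket
  have hEq : S ((M₀ : ℝ)⁻¹, εU) =
      CW * (4 * C7 * ((4 * ((d + 1 : ℕ) : ℝ) * L / M₀) ^ 2 * k * Λ)) +
        (1 - γ₁) *
          ((16 * ((d + 1 : ℕ) : ℝ) * ((1 + MT) * MT * (64 * ((M₀ : ℝ) * η)⁻¹ ^ 2)) +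
                8 * ((d + 1 : ℕ) : ℝ) * MT ^ 2 * (64 * ((M₀ : ℝ) * η)⁻¹ ^ 2)) +
            (2 * ((d + 1 : ℕ) : ℝ) * ((1 + MT) * MT * (64 * ((M₀ : ℝ) * η)⁻¹ ^ 2)) +
                ((d + 1 : ℕ) : ℝ) * MT ^ 2 * (64 * ((M₀ : ℝ) * η)⁻¹ ^ 2)) +
            a * ((sC + θ₁ * (102 * (((d + 1 : ℕ) : ℝ) + 1) ^ 2 * L * εU)) *
                (256 * ((d + 1 : ℕ) : ℝ) * ((L : ℝ) - 1) ^ 2 / (M₀ : ℝ) ^ 2 * sC + 4 * (θ₁ * (102 * (((d + 1 : ℕ) : ℝ) + 1) ^ 2 * L * εU))) +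
              (2 * (256 * ((d + 1 : ℕ) : ℝ) * ((L : ℝ) - 1) ^ 2 / (M₀ : ℝ) ^ 2 * rr) +
                8 * (θ₁ * (102 * (((d + 1 : ℕ) : ℝ) + 1) ^ 2 * L * εU)) ^ 2))) := by
    rw [hS, hdR]
    simp only []
    ring
  linarith [hlt, hEq]

end Literature.MathematicalPhysics.QuantumFieldTheory.Balaban1983to89.B9Eq387IMSMassWindow

end
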